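import Summits.NavierStokesRegularity.FluidComputer.GateBudgetHeadline
import Summits.NavierStokesRegularity.FluidComputer.GateBudgetFiringWindow
import HarnessLib

/-!
# What no tuning can beat, part 23: THE COMB AT TAO'S AMPLIFIER — at `M = K¹⁰` every dyadic
# knob window with `200ε/K²⁰ ≤ ρhi² ≤ 4ε/(3K¹⁰)` contains a member whose output stays below
# `1/10` until after its clock has died AND a member whose output passes `3/4` for good

Cell `pub-fluidc`, blueprint seat bp1 (gen 30, second item); same namespace and conventions as
parts 1–22 (`GateBudget*.lean`); imports part 21 (`GateBudgetHeadline`: the trigger, smallness,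
window-length, drift and afterglow numerics at `M = K¹⁰`, and the dud headline) and part 22b
(`GateBudgetFiringWindow`: the half-lattice member fires, `knob_window_member_fires`). Modes
`0 = a` input, `1 = b` clock, `2 = c` catalyst, `3 = d` transfer, `4 = ã` output;
`σ_knob = ρ²/ε`. HONEST FRAMING (verbatim): low prior, high value-of-information experiment on
Tao's machine paradigm; NOT a claim that NS blows up.

THE POINT. Part 21 discharged the largeness hypotheses of the dud at Tao's own amplifier
`M = K¹⁰` with the crude phase budget `ψ = 3/4` (winding number up to `K¹⁰/10`), which caps the
dud's output at `ã² ≤ 1/2` — too weak to separate it from a firing member. §67 sharpens the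
numerics on the sub-window of winding number `κ = 2ε/(K¹⁰ρhi²) ≤ K¹⁰/100` (`200ε/K²⁰ ≤ ρhi²`):
the phase budget is `≤ 7/100` (`teeth_psi`: critical winding `≤ π/49`, `π < 3.15`), the transfer
afterglow of part 22 is `≤ 10⁻³` (`teeth_afterglow`), and with `ψ = 7/100`, `D = 10⁻³` the firing
condition of part 22 holds with `θ = 3/4` for every `K ≥ 16` (`teeth_fire`:
`(K/8)((1 - ψ²/2 - D)² - 10⁻³ - 9/16) ≥ 0.859`). §68 (`knob_window_comb_headline`): for `K ≥ 16`,
`0 < ε`, `ε² ≤ 1/(6K²⁰)` and exact trajectories `X r` of `rotorCircuit K K¹⁰ ε r` from (5.6), EVERY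
window `[ρhi²/2, ρhi²]` with `200ε/K²⁰ ≤ ρhi²` and `3K¹⁰ρhi² ≤ 4ε` contains (a) a member whose
output obeys `ã(t)² ≤ 1/100` for all `0 ≤ t ≤ T + 1/8` (part 20's lattice dud, sharpened) AND
(b) a member with `|a(T)| ≤ 71/1000`, `|d(T)| ≥ 99/100` at its clock death and `ã(t) ≥ 3/4` for
all `t ≥ T + 1/8` (part 22's tooth), each with its own times `1 ≤ s₀ ≤ 3/2 < T ≤ s₀ + 242/K⁹`.
THE KNOB'S RESPONSE AT SCALE `σ_knob·K¹⁰ ~ 1` IS A COMB WITH TEETH OF FULL HEIGHT: within every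
factor-two window of the knob the output after the pulse ranges from below `1/10` to above `3/4`
— no statement of the form "the gate fires (or: does not fire) for all knobs in a window" can
hold at this scale, whatever the tuning of the remaining parameters inside the polynomial regime.

HONEST LIMITS. (i) Member-specific times: (a) holds on `[0, T_a + 1/8]` and (b) from `T_b + 1/8`
on, with `T_a`, `T_b ∈ (1, 3/2 + 242/K⁹]` the two members' OWN dousing times; a common instant
at which (a) and (b) both hold exists iff `T_b ≤ T_a`, which is NOT decided here — a common-time
comb needs the order of the dousing times across the window or the second-pulse exclusion for
the dud (part 10's no-return with the armed radius re-bought), neither done here. (ii) The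
winding-number range `3/2 ≤ κ ≤ K¹⁰/100` leaves out the windows
`4ε/(3K¹⁰) < ρhi² ≤ 2ε/K¹⁰` (no half-lattice point, part 22 HONEST LIMITS (ii)) and
`20ε/K²⁰ ≤ ρhi² < 200ε/K²⁰` (phase budget above `7/100`; part 21's dud survives there with
`ã² ≤ 1/2`). (iii) Only `M = K¹⁰`; other polynomial amplifiers need their own routine numerics.
(iv) Nothing is claimed about members off the two lattices, or about Navier–Stokes.
[cite: Tao2016AveragedNS, §5.5 Theorem 5.3, (5.5), (5.6), (b-eq), (c-eq), (tcable)]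
-/

noncomputable section

namespace Summit.NavierStokesRegularity.FluidComputer.GateBudget

open Real Set Filter Topology
open Literature.Analysis.FluidPDE.Tao2016AveragedNS

/-! ## §67 Routine numerics of the teeth at `M = K¹⁰` -/

/-- **The phase budget on the comb window, at `M = K¹⁰`.** For a window with `200ε/K²⁰ ≤ ρhi²`
(winding number `κ = 2ε/(K¹⁰ρhi²) ≤ K¹⁰/100`) and any `0 ≤ Δ ≤ 1`, part 20's closed-form phase
budget at `M = K¹⁰` is at most `7/100`: the critical winding contributes `≤ (π/49)·(49/48)`
(`π < 3.15`), every other term `≤ 10⁻³`.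
[cite: Tao2016AveragedNS, §5.5 Theorem 5.3, (b-eq), (c-eq)] -/
theorem teeth_psi {K ε ρhi Δ : ℝ} (hK : 16 ≤ K) (hε : 0 < ε) (hlo : 200 * ε / K ^ 20 ≤ ρhi ^ 2)
    (hΔ0 : 0 ≤ Δ) (hΔ : Δ ≤ 1) :
    6 / (K ^ 10 * K ^ 10) + 16 * exp (-K ^ 10) / (K ^ 10) ^ 2 +
      (2 * ε / (K ^ 10 * ρhi ^ 2) * (π * (100 / (49 * K ^ 10))) +
        10 * exp (-K ^ 10) * Δ / (7 * K ^ 10)) / (1 - 100 / (49 * K ^ 10)) + 3 / (2 * K ^ 10)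
      ≤ 7 / 100 := by
  have hK0 : 0 < K := by linarith
  have h10 : (1099511627776 : ℝ) ≤ K ^ 10 := by
    have := headline_pow_floor hK 10; norm_num at this; exact this
  have hK10 : 0 < K ^ 10 := by positivity
  have hρ2 : 0 < ρhi ^ 2 := lt_of_lt_of_le (by positivity) hlo
  have hlo' : 200 * ε ≤ ρhi ^ 2 * K ^ 20 := by rwa [div_le_iff₀ (by positivity)] at hlo
  have hexp : exp (-K ^ 10) ≤ 1 / K ^ 10 := headline_exp_le hK
  have hexp1 : exp (-K ^ 10) ≤ 1 := hexp.trans ((div_le_one hK10).2 (by linarith))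
  have hexp0 : 0 < exp (-K ^ 10) := Real.exp_pos _
  have hsq : (1099511627776 : ℝ) * 1099511627776 ≤ K ^ 10 * K ^ 10 :=
    mul_le_mul h10 h10 (by norm_num) hK10.le
  have t1 : 6 / (K ^ 10 * K ^ 10) ≤ 1 / 1000 := by
    rw [div_le_div_iff₀ (by positivity) (by norm_num)]; nlinarith [hsq]
  have t2 : 16 * exp (-K ^ 10) / (K ^ 10) ^ 2 ≤ 1 / 1000 := by
    rw [div_le_div_iff₀ (by positivity) (by norm_num)]; nlinarith [hsq, hexp1, hexp0]
  have hκ : 2 * ε / (K ^ 10 * ρhi ^ 2) ≤ K ^ 10 / 100 := by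
    rw [div_le_div_iff₀ (by positivity) (by norm_num)]
    have h1 : K ^ 10 * (K ^ 10 * ρhi ^ 2) = ρhi ^ 2 * K ^ 20 := by ring
    rw [h1]; linarith [hlo']
  have tκ : 2 * ε / (K ^ 10 * ρhi ^ 2) * (π * (100 / (49 * K ^ 10))) ≤ π / 49 := by
    calc 2 * ε / (K ^ 10 * ρhi ^ 2) * (π * (100 / (49 * K ^ 10)))
        ≤ K ^ 10 / 100 * (π * (100 / (49 * K ^ 10))) :=
          mul_le_mul_of_nonneg_right hκ (by positivity)
      _ = π / 49 := by field_simp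
  have tδ : 10 * exp (-K ^ 10) * Δ / (7 * K ^ 10) ≤ 1 / 1000 := by
    have h1 : exp (-K ^ 10) * Δ ≤ 1 := by
      calc exp (-K ^ 10) * Δ ≤ 1 * Δ := mul_le_mul_of_nonneg_right hexp1 hΔ0
        _ ≤ 1 := by linarith
    rw [div_le_div_iff₀ (by positivity) (by norm_num)]; nlinarith [h1, h10]
  have hq : 48 / 49 ≤ 1 - 100 / (49 * K ^ 10) := by
    have h1 : 100 / (49 * K ^ 10) ≤ 1 / 49 := by
      rw [div_le_div_iff₀ (by positivity) (by norm_num)]; linarith [h10]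
    linarith
  have hN0 : 0 ≤ 2 * ε / (K ^ 10 * ρhi ^ 2) * (π * (100 / (49 * K ^ 10))) +
      10 * exp (-K ^ 10) * Δ / (7 * K ^ 10) := by positivity
  have hquot : (2 * ε / (K ^ 10 * ρhi ^ 2) * (π * (100 / (49 * K ^ 10))) +
      10 * exp (-K ^ 10) * Δ / (7 * K ^ 10)) / (1 - 100 / (49 * K ^ 10)) ≤
      (π / 49 + 1 / 1000) / (48 / 49) :=
    (div_le_div_of_nonneg_left hN0 (by norm_num) hq).trans
      (div_le_div_of_nonneg_right (by linarith [tκ, tδ]) (by norm_num))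
  have t3 : 3 / (2 * K ^ 10) ≤ 1 / 1000 := by
    rw [div_le_div_iff₀ (by positivity) (by norm_num)]; linarith [h10]
  linarith [t1, t2, hquot, t3, Real.pi_lt_d2]

/-- **The transfer afterglow, at `M = K¹⁰`.** Part 22's `A′ = 8(K⁻¹⁰ + 4e^{-M}/M)/M + e^{-M}/M` at
`M = K¹⁰`, `K ≥ 16` is at most `10⁻³`. [cite: Tao2016AveragedNS, §5.5 Theorem 5.3, (5.5)] -/
theorem teeth_afterglow {K : ℝ} (hK : 16 ≤ K) :
    8 * (1 / K ^ 10 + 4 * exp (-K ^ 10) / K ^ 10) / K ^ 10 + exp (-K ^ 10) / K ^ 10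
      ≤ 1 / 1000 := by
  have hK0 : 0 < K := by linarith
  have h10 : (1099511627776 : ℝ) ≤ K ^ 10 := by
    have := headline_pow_floor hK 10; norm_num at this; exact this
  have hK10 : 0 < K ^ 10 := by positivity
  have hexp1 : exp (-K ^ 10) ≤ 1 :=
    (headline_exp_le hK).trans ((div_le_one hK10).2 (by linarith))
  have h4 : 4 * exp (-K ^ 10) / K ^ 10 ≤ 4 / K ^ 10 :=
    div_le_div_of_nonneg_right (by linarith [hexp1]) hK10.le
  have h1 : exp (-K ^ 10) / K ^ 10 ≤ 1 / K ^ 10 :=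
    div_le_div_of_nonneg_right hexp1 hK10.le
  have hu : 1 / K ^ 10 ≤ 1 / 1000000 := one_div_le_one_div_of_le (by norm_num) (by linarith [h10])
  have hin : 1 / K ^ 10 + 4 * exp (-K ^ 10) / K ^ 10 ≤ 1 := by
    linarith [h4, hu, show (4:ℝ) / K ^ 10 = 4 * (1 / K ^ 10) by ring]
  have h8 : 8 * (1 / K ^ 10 + 4 * exp (-K ^ 10) / K ^ 10) / K ^ 10 ≤ 8 * 1 / K ^ 10 :=
    div_le_div_of_nonneg_right (by nlinarith [hin]) hK10.le
  linarith [h8, h1, hu, show (8:ℝ) * 1 / K ^ 10 = 8 * (1 / K ^ 10) by ring]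

/-- **The tooth fires to `3/4`, at `M = K¹⁰`.** With `ψ = 7/100`, `D = 10⁻³` and the transfer
afterglow `≤ 10⁻³` of `teeth_afterglow`, part 22's firing condition
`θ ≤ (K/8)((1 - ψ²/2 - D)² - A′ - θ²)` holds with `θ = 3/4` for every `K ≥ 16`
(`(1 - ψ²/2 - D)² > 0.993`, `K/8 ≥ 2`).
[cite: Tao2016AveragedNS, §5.5 Theorem 5.3, (5.5), (ta-eq)] -/
theorem teeth_fire {K : ℝ} (hK : 16 ≤ K) :
    (3 / 4 : ℝ) ≤ K / 8 * ((1 - (7 / 100 : ℝ) ^ 2 / 2 - 1 / 1000) ^ 2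
      - (8 * (1 / K ^ 10 + 4 * exp (-K ^ 10) / K ^ 10) / K ^ 10 + exp (-K ^ 10) / K ^ 10)
      - (3 / 4 : ℝ) ^ 2) := by
  have hA := teeth_afterglow hK
  have hK8 : (0 : ℝ) ≤ K / 8 := by linarith
  have h := mul_le_mul_of_nonneg_left hA hK8
  nlinarith [h, hK]

/-! ## §68 The comb at Tao's amplifier -/

/-- **THE COMB AT TAO'S AMPLIFIER (S13″c and its mirror image, hypothesis-free form).** Let
`K ≥ 16`, `0 < ε`, `ε² ≤ 1/(6K²⁰)`, and let `X r` be, for every knob value `r`, an exact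
trajectory of `rotorCircuit K K¹⁰ ε r` from the initial datum (5.6) (`C r` a primitive of its
catalyst). EVERY window `[ρhi²/2, ρhi²]` of knobs with `200ε/K²⁰ ≤ ρhi²` and `3K¹⁰ρhi² ≤ 4ε`
contains (a) a member `r` whose output satisfies `ã(t)² ≤ 1/100` for all `t ∈ [0, T + 1/8]`
(part 20's lattice dud at `ψ = 7/100`, `D = 10⁻³`), and (b) a member `r'` which leaves its pulse
in transfer phase, `|a(T)| ≤ 71/1000`, `|d(T)| ≥ 99/100`, and whose output satisfies
`ã(t) ≥ 3/4` for all `t ≥ T + 1/8` (part 22's half-lattice tooth, `θ = 3/4`) — each with its own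
times `1 ≤ s₀ ≤ 3/2 < T ≤ s₀ + 242/K⁹`. Neither firing nor not-firing is robust in the knob at
scale `σ_knob·K¹⁰ ~ 1`. HONEST LIMITS (i)–(iv) of the header; nothing about NS.
[cite: Tao2016AveragedNS, §5.5 Theorem 5.3, (5.5), (5.6), (b-eq), (c-eq), (tcable)] -/
theorem knob_window_comb_headline {K ε : ℝ} {X : ℝ → ℝ → Fin 5 → ℝ} {C : ℝ → ℝ → ℝ}
    (hX : ∀ r t, HasDerivAt (X r) (RotorKnob.rotorCircuit K (K ^ 10) ε r (X r t)) t)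
    (h0 : ∀ r, X r 0 = delayInit) (hC : ∀ r t, HasDerivAt (C r) (X r t 2) t)
    (hK : 16 ≤ K) (hε : 0 < ε) (hεK : ε ^ 2 ≤ 1 / (6 * K ^ 20)) {ρhi : ℝ} (hρhi : 0 < ρhi)
    (hlo : 200 * ε / K ^ 20 ≤ ρhi ^ 2) (hhi : 3 * (K ^ 10 * ρhi ^ 2) ≤ 4 * ε) :
    (∃ r : ℝ, 0 < r ∧ ρhi ^ 2 / 2 ≤ r ^ 2 ∧ r ^ 2 ≤ ρhi ^ 2 ∧
      ∃ s₀ T : ℝ, 1 ≤ s₀ ∧ s₀ ≤ 3 / 2 ∧ s₀ < T ∧ T - s₀ ≤ 242 / K ^ 9 ∧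
        ∀ t ∈ Icc 0 (T + 1 / 8), X r t 4 ^ 2 ≤ 1 / 100) ∧
    (∃ r : ℝ, 0 < r ∧ ρhi ^ 2 / 2 ≤ r ^ 2 ∧ r ^ 2 ≤ ρhi ^ 2 ∧
      ∃ s₀ T : ℝ, 1 ≤ s₀ ∧ s₀ ≤ 3 / 2 ∧ s₀ < T ∧ T - s₀ ≤ 242 / K ^ 9 ∧
        |X r T 0| ≤ 71 / 1000 ∧ 99 / 100 ≤ |X r T 3| ∧ ∀ t, T + 1 / 8 ≤ t → 3 / 4 ≤ X r t 4) := by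
  have hK0 : 0 < K := by linarith
  have hK10 : 0 < K ^ 10 := by positivity
  have h9 : (68719476736 : ℝ) ≤ K ^ 9 := by
    have := headline_pow_floor hK 9; norm_num at this; exact this
  have hH : (242 : ℝ) / K ^ 9 < 1 / 16 := by
    rw [div_lt_div_iff₀ (by positivity) (by norm_num)]; linarith [h9]
  have hΔ0 : (0 : ℝ) ≤ 242 / K ^ 9 := by positivity
  have hm : (0 : ℝ) ≤ 1 - (7 / 100 : ℝ) ^ 2 / 2 - 1 / 1000 := by norm_num
  -- the comb window lies inside part 21's window: `20ε/K²⁰ ≤ ρhi²`, `K¹⁰ρhi² ≤ 2ε`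
  have hlo20 : 20 * ε / K ^ 20 ≤ ρhi ^ 2 :=
    le_trans (div_le_div_of_nonneg_right (by linarith) (by positivity)) hlo
  have hhi2 : K ^ 10 * ρhi ^ 2 ≤ 2 * ε := by linarith
  have hψ := teeth_psi hK hε hlo hΔ0 (by linarith)
  constructor
  · -- (a) the dud: part 20 at `ψ = 7/100`, `D = 10⁻³`, numerics of part 21 and §67
    obtain ⟨r, hr0, hr1, hr2, s₀, T, hs1, hs2, hsT, hTs, hcap⟩ :=
      knob_window_member_dud hX h0 hC hε hK10 le_rfl hK (headline_trigger hK) hεK hρhi hhi2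
        (headline_delta hK hε hlo20) hH hψ (headline_drift hK hεK hhi2) hm
    refine ⟨r, hr0, hr1, hr2, s₀, T, hs1, hs2, hsT, hTs, fun t ht => ?_⟩
    nlinarith [hcap t ht, headline_afterglow hK hεK (ε := ε), hm]
  · -- (b) the tooth: part 22 at `ψ = 7/100`, `D = 10⁻³`, `θ = 3/4`
    obtain ⟨r, hr0, hr1, hr2, s₀, T, hs1, hs2, hsT, hTs, ha, hd, hfire⟩ :=
      knob_window_member_fires hX h0 hC hε hK10 le_rfl hK (headline_trigger hK) hεK hρhi hhi
        (headline_delta hK hε hlo20) hH hψ (headline_drift hK hεK hhi2) hm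
        (by norm_num : (0 : ℝ) ≤ 3 / 4) (teeth_fire hK)
    refine ⟨r, hr0, hr1, hr2, s₀, T, hs1, hs2, hsT, hTs, by linarith, by nlinarith [hd], hfire⟩

end Summit.NavierStokesRegularity.FluidComputer.GateBudget
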